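import Summits.CriticalPhenomena.Ising3DConformalLimit.Theses.BallOrbitComparison

/-!
# Birth skeleton for crux `OrbitInversionRatio` (item `stmt-CriticalPhenomena-5044`)

Route `route-CriticalPhenomena-BallOrbitComparison` (sub-problem `Ising3DConformalLimit`),
crux r2 `OrbitInversionRatio` (OIR, the covariance crux): for `Ω, Ω′` in the Möbius orbit of the
ball `𝒪 = {open balls, open exteriors of balls, open half-spaces}` exchanged by the unit inversion
`ι` (`ι(Ω∖0) ⊆ Ω′`, `ι(Ω′∖0) ⊆ Ω`), every `n` and every non-coincident `x ∈ (Ω∖{0})ⁿ`,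
`G_Ω′^δ([ιx/δ]) / G_Ω^δ([x/δ]) → ∏ᵢ ‖xᵢ‖^(2Δ)` as `δ → 0⁺`, where `G_Ω^δ` is the `+` b.c. critical
correlation of the lattice region `{z : δz ∈ Ω}` and `Δ` the regular-variation index of the
canonical renormalisation `ρ_c(δ) = ⟨σ₀σ_(⌊1/δ⌋e₀)⟩^(−1/2)`.

## The line (birth certificate BC3; two registered stubs and a kernel-checked composition)

EXISTENCE / IDENTIFICATION — the classical two halves of a scaling-limit theorem
(Chelkak–Hongler–Izyurov 2015, Thm 1.2: precompactness + identification of the limit), read on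
the orbit `𝒪` with `+` boundary conditions.

* `stub_orbitLimits` (open; EXISTENCE with boundary hyperscaling): for every `Ω ∈ 𝒪` the
  `ρ_c`-renormalised `+` b.c. correlations `ρ_c(δ)ⁿ G_Ω^δ([x/δ])` converge POINTWISE at every
  non-coincident `x ∈ Ωⁿ` to a limit `S_Ω n x`, and the limit is POSITIVE.  For balls this is the
  pointwise shadow of the sibling crux `BallLimits` (item 5045) plus positivity; for half-spaces and
  exteriors it is the corresponding infinite-volume statement.  Positivity of the one-point limit
  `lim ρ_c(δ)⟨σ_[x/δ]⟩⁺_Ω > 0` is the lower half of boundary-magnetisation hyperscaling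
  (`⟨σ₀⟩⁺_(B_ℓ) ≍ ⟨σ₀σ_(ℓe₀)⟩^(1/2)`); `n`-point positivity then follows from GKS II.
* `stub_limitCovariance` (open, LOAD-BEARING — the conformal content): for an `ι`-pair
  `Ω, Ω′ ∈ 𝒪` and ANY pointwise limit families `S_Ω`, `S_Ω′` as above,
  `S_Ω′ n (ιx) = (∏ᵢ ‖xᵢ‖^(2Δ)) · S_Ω n x` for non-coincident `x ∈ (Ω∖0)ⁿ` — inversion covariance
  of the `+` b.c. limit profiles on the orbit (at `n = 1` on ball ↔ half-space this is the
  Burkhardt–Eisenriegler / Cardy profile law, `⟨σ⟩_centre = 2^Δ ⟨σ⟩_wall`).  It is implied by the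
  crux (limits along `𝓝[>] 0` are unique) and gives it back only together with existence AND
  positivity (stub 1).

Composition `OrbitInversionRatio_of`: for an `ι`-pair and admissible `x`, `ιx` is non-coincident
(`ι` is injective, `EuclideanGeometry.inversion_injective`) and lies in `Ω′ⁿ` (the `MapsTo`
hypothesis); stub 1 gives the two renormalised limits, `S_Ω n x > 0`; stub 2 identifies the
numerator's limit as `(∏‖xᵢ‖^(2Δ))·S_Ω n x`; `Tendsto.div` gives the limit of the renormalised
quotient, and the renormalisations cancel eventually (`ρ_c(δ)ⁿ ≠ 0` eventually because
`ρ_c(δ)ⁿ G_Ω^δ → S_Ω n x ≠ 0`).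

No new mathematical objects: `G`, `ρ`, `orbit`, `ι`, `RV` are verbatim local names for the route's
`let`-bound vocabulary (the restatement `orbitInversionRatio_iff` is `Iff.rfl`); `IsDomainLimit`
abbreviates "pointwise renormalised limit on `Ω`".
-/

noncomputable section

namespace Summit.CriticalPhenomena.Ising3DConformalLimit.Cruxes.OrbitInversionRatio.Birth

open scoped BigOperators Topology Manifold Classical MeasureTheory ProbabilityTheory Matrix InnerProductSpace ComplexConjugate ContinuousMap
open Filter Set Function TopologicalSpace MeasureTheory
open Literature.Probability.LatticeModels

local notation "E" => EuclideanSpace ℝ (Fin 3)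

/-! ### The route's vocabulary (verbatim copies of the `let`-bound terms of the crux) -/

/-- The route's `+` b.c. critical `n`-point function of the lattice region `{z ∈ ℤ³ : δz ∈ Ω}`
(spins outside frozen `+`; `L → ∞` limit along boxes) — the crux's `G`, verbatim. -/
def G (Ω : Set E) (δ : ℝ) (n : ℕ) (y : Fin n → Site 3) : ℝ :=
  Filter.limUnder Filter.atTop (fun L : ℕ => Literature.Probability.LatticeModels.isingExpect (Literature.Probability.LatticeModels.zdGraph 3) ((Literature.Probability.LatticeModels.box 3 L).filter (fun z => (WithLp.toLp 2 (fun i : Fin 3 => δ * (z i : ℝ)) : EuclideanSpace ℝ (Fin 3)) ∈ Ω)) (Literature.Probability.LatticeModels.criticalBeta 3) 0 Literature.Probability.LatticeModels.BoundaryCondition.plus (Literature.Probability.LatticeModels.spinMonomial y))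

/-- The canonical renormalisation `ρ_c(δ) = ⟨σ₀ σ_(⌊1/δ⌋e₀)⟩_(β_c)^(−1/2)` — the crux's `ρ`. -/
def ρ (δ : ℝ) : ℝ :=
  1 / Real.sqrt (Literature.Probability.LatticeModels.criticalTwoPoint 3 (Pi.single 0 ⌊δ⁻¹⌋))

/-- The Möbius orbit of the ball: open balls, open exteriors of balls, open half-spaces — the
crux's `O`, verbatim. -/
def orbit : Set (Set E) :=
  {Ω | (∃ c R, 0 < R ∧ Ω = Metric.ball c R) ∨ (∃ c R, 0 < R ∧ Ω = {x | R < dist x c}) ∨ (∃ (v : EuclideanSpace ℝ (Fin 3)) (t : ℝ), v ≠ 0 ∧ Ω = {x | t < inner ℝ v x})}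

/-- The unit inversion `ι(z) = z/‖z‖²` about the origin. -/
def ι : E → E := EuclideanGeometry.inversion (0 : E) 1

/-- The route's regular-variation hypothesis on `ρ_c` with index `Δ`:
`ρ_c(cδ)/ρ_c(δ) → c^(−Δ)` as `δ → 0⁺` for every `c > 0`. -/
def RV (Δ : ℝ) : Prop :=
  ∀ c : ℝ, 0 < c → Tendsto (fun δ => ρ (c * δ) / ρ δ) (𝓝[>] (0 : ℝ)) (𝓝 (c ^ (-Δ)))

/-- `S` is a POINTWISE renormalised scaling limit of the `+` b.c. correlations of `Ω`:
`ρ_c(δ)ⁿ G_Ω^δ([x₁/δ],…,[xₙ/δ]) → S n x` as `δ → 0⁺` for every non-coincident `x ∈ Ωⁿ`.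
(Limits along `𝓝[>] 0` are unique, so `S` is pinned there; elsewhere it is unconstrained.) -/
def IsDomainLimit (Ω : Set E) (S : CorrFamily 3) : Prop :=
  ∀ n, ∀ x ∈ NonCoincident 3 n, (∀ i, x i ∈ Ω) →
    Tendsto (fun δ : ℝ => ρ δ ^ n * G Ω δ n (fun i => latticeApprox δ (x i)))
      (𝓝[>] (0 : ℝ)) (𝓝 (S n x))

/-- The crux, read through the local vocabulary, is DEFINITIONALLY the route decl. -/
theorem orbitInversionRatio_iff :
    Summit.CriticalPhenomena.Ising3DConformalLimit.Theses.BallOrbitComparison.OrbitInversionRatio ↔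
    (∀ Δ : ℝ, RV Δ → ∀ Ω ∈ orbit, ∀ Ω' ∈ orbit, MapsTo ι (Ω \ {0}) Ω' → MapsTo ι (Ω' \ {0}) Ω →
      ∀ n, ∀ x ∈ NonCoincident 3 n, (∀ i, x i ∈ Ω ∧ x i ≠ 0) →
        Tendsto (fun δ : ℝ => G Ω' δ n (fun i => latticeApprox δ (ι (x i))) /
            G Ω δ n (fun i => latticeApprox δ (x i)))
          (𝓝[>] (0 : ℝ)) (𝓝 (∏ i, ‖x i‖ ^ (2 * Δ)))) :=
  Iff.rfl

/-! ### Statements of the two stubs -/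

/-- Statement of STUB 1 (existence and positivity of renormalised `+` b.c. limits on the orbit). -/
def OrbitLimits : Prop :=
  ∀ Ω ∈ orbit, ∃ S : CorrFamily 3, IsDomainLimit Ω S ∧
    ∀ n, ∀ x ∈ NonCoincident 3 n, (∀ i, x i ∈ Ω) → 0 < S n x

/-- Statement of STUB 2 (inversion covariance of the limit profiles on `ι`-pairs of the orbit). -/
def LimitCovariance : Prop :=
  ∀ Δ : ℝ, RV Δ → ∀ Ω ∈ orbit, ∀ Ω' ∈ orbit, MapsTo ι (Ω \ {0}) Ω' → MapsTo ι (Ω' \ {0}) Ω →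
    ∀ S S' : CorrFamily 3, IsDomainLimit Ω S → IsDomainLimit Ω' S' →
      ∀ n, ∀ x ∈ NonCoincident 3 n, (∀ i, x i ∈ Ω ∧ x i ≠ 0) →
        S' n (fun i => ι (x i)) = (∏ i, ‖x i‖ ^ (2 * Δ)) * S n x

/-! ### The registered stubs (both carry `sorry`) -/

/-- STUB 1 (open; XL) — `OrbitLimits`: for every `Ω` in the orbit (ball, exterior of a ball,
half-space) there is `S_Ω : CorrFamily 3` with `ρ_c(δ)ⁿ G_Ω^δ([x/δ]) → S_Ω n x` as `δ → 0⁺` and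
`0 < S_Ω n x`, for every `n` and every non-coincident `x ∈ Ωⁿ`.  Plausibly true: for balls it is
the pointwise form of the route's `BallLimits` (finite systems); for half-spaces/exteriors the
same universality-of-`+`-boundary bet in infinite volume (the `L → ∞` limit in `G` exists by GKS
monotonicity, `isingCorr_plus_le_of_subset`); finiteness under `ρ_c` is the upper half and
positivity the lower half of boundary hyperscaling `⟨σ₀⟩⁺_(B_ℓ) ≍ ⟨σ₀σ_(ℓe₀)⟩^(1/2)` (`n`-point
positivity from one-point positivity by GKS II; `n = 0` gives `S 0 = 1`).  Why it might fail:
no one-arm / boundary-magnetisation hyperscaling is known on `ℤ³` (arXiv:2406.15243, Open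
problem 1), and uniqueness of the `δ → 0` limit has no mechanism in `d = 3` beyond subsequences.
[AizenmanDuminilCopinSidoravicius2015 §1; FriedliVelenik2017 §3.6–3.10; arXiv:2406.15243;
DuminilCopinICM2022 §8.4] -/
theorem stub_orbitLimits :
    ∀ Ω ∈ orbit, ∃ S : CorrFamily 3, IsDomainLimit Ω S ∧
      ∀ n, ∀ x ∈ NonCoincident 3 n, (∀ i, x i ∈ Ω) → 0 < S n x := by
  sorry

/-- STUB 2 (open; XL, LOAD-BEARING) — `LimitCovariance`: for `Δ` with `ρ_c` regularly varying of
index `−Δ`, an `ι`-pair `Ω, Ω′` of the orbit (`ι(Ω∖0) ⊆ Ω′`, `ι(Ω′∖0) ⊆ Ω`) and ANY pointwise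
renormalised limits `S_Ω`, `S_Ω′`: `S_Ω′ n (ιx₁,…,ιxₙ) = (∏ᵢ ‖xᵢ‖^(2Δ)) · S_Ω n x` for
non-coincident `x ∈ (Ω∖0)ⁿ` — the conformal factor of `ι` is `|ι′(x)| = ‖x‖^(−2)`, so this is
`⟨∏σ(ιxᵢ)⟩_(ιΩ) ∏|ι′(xᵢ)|^Δ = ⟨∏σ(xᵢ)⟩_Ω`, inversion covariance of `+` b.c. profiles; at `n = 1`
on ball ↔ half-space it is the Burkhardt–Eisenriegler/Cardy law (ball profile `(2R/(R²−|x|²))^Δ`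
from the wall profile `d^(−Δ)`), on ball ↔ ball the Loewner–Nirenberg shape.  Implied by the
crux (uniqueness of limits); conversely the crux needs stub 1 as well.  Why it might fail: a
scale- but not conformally covariant critical point (virial current) would make the two profiles
differ by a non-constant factor; no lattice mechanism for `ι` is known in `d = 3`.
[Cardy1996 Ex. 11.2; BurkhardtEisenriegler1985; arXiv:1904.08919; ChelkakHonglerIzyurov2015
Thm 1.2 (planar analogue)] -/
theorem stub_limitCovariance :
    ∀ Δ : ℝ, RV Δ → ∀ Ω ∈ orbit, ∀ Ω' ∈ orbit, MapsTo ι (Ω \ {0}) Ω' → MapsTo ι (Ω' \ {0}) Ω →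
      ∀ S S' : CorrFamily 3, IsDomainLimit Ω S → IsDomainLimit Ω' S' →
        ∀ n, ∀ x ∈ NonCoincident 3 n, (∀ i, x i ∈ Ω ∧ x i ≠ 0) →
          S' n (fun i => ι (x i)) = (∏ i, ‖x i‖ ^ (2 * Δ)) * S n x := by
  sorry

/-- The inline signature of stub 1 is the named statement. -/
theorem orbitLimits_holds : OrbitLimits := stub_orbitLimits
/-- The inline signature of stub 2 is the named statement. -/
theorem limitCovariance_holds : LimitCovariance := stub_limitCovariance

/-! ### Name-keyed aliases of the statements (the hypotheses of the composition) -/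
namespace Registered

/-- Alias of `OrbitLimits` keyed by the registered stub name. -/
abbrev stub_orbitLimits : Prop := OrbitLimits
/-- Alias of `LimitCovariance` keyed by the registered stub name. -/
abbrev stub_limitCovariance : Prop := LimitCovariance

end Registered

/-! ### The composition: the two stubs imply the crux, by name (real proof, no `sorry`) -/

/-- `OrbitInversionRatio` from the stubs.  For an `ι`-pair `Ω, Ω′ ∈ 𝒪` and non-coincident
`x ∈ (Ω∖0)ⁿ`: `ιx` is non-coincident (injectivity of `ι`) and lies in `Ω′ⁿ` (`MapsTo`); stub 1
gives `ρⁿG_Ω^δ([x/δ]) → S n x > 0` and `ρⁿG_Ω′^δ([ιx/δ]) → S′ n (ιx)`; stub 2 rewrites the latter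
limit as `(∏‖xᵢ‖^(2Δ)) S n x`; the renormalised quotient tends to `∏‖xᵢ‖^(2Δ)` (`Tendsto.div`),
and it agrees eventually with the bare quotient since `ρ(δ)ⁿ ≠ 0` eventually
(`ρⁿG_Ω^δ → S n x ≠ 0`). -/
theorem OrbitInversionRatio_of (hLim : Registered.stub_orbitLimits)
    (hCov : Registered.stub_limitCovariance) :
    Summit.CriticalPhenomena.Ising3DConformalLimit.Theses.BallOrbitComparison.OrbitInversionRatio := by
  rw [orbitInversionRatio_iff]
  intro Δ hΔ Ω hΩ Ω' hΩ' hm hm' n x hx hxΩ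
  obtain ⟨S, hS, hSpos⟩ := hLim Ω hΩ
  obtain ⟨S', hS', -⟩ := hLim Ω' hΩ'
  have hxΩ1 : ∀ i, x i ∈ Ω := fun i => (hxΩ i).1
  have hx0 : ∀ i, x i ≠ 0 := fun i => (hxΩ i).2
  -- the inverted configuration is admissible for `Ω'`
  have hιinj : (fun i => ι (x i)) ∈ NonCoincident 3 n :=
    (EuclideanGeometry.inversion_injective (0 : E) one_ne_zero).comp hx
  have hιmem : ∀ i, ι (x i) ∈ Ω' := fun i => hm ⟨hxΩ1 i, hx0 i⟩
  -- stub 1: the two renormalised limits, positivity of the denominator's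
  have h1 : Tendsto (fun δ : ℝ => ρ δ ^ n * G Ω δ n (fun i => latticeApprox δ (x i)))
      (𝓝[>] (0 : ℝ)) (𝓝 (S n x)) := hS n x hx hxΩ1
  have h2 : Tendsto (fun δ : ℝ => ρ δ ^ n * G Ω' δ n (fun i => latticeApprox δ (ι (x i))))
      (𝓝[>] (0 : ℝ)) (𝓝 (S' n (fun i => ι (x i)))) := hS' n (fun i => ι (x i)) hιinj hιmem
  have hpos : 0 < S n x := hSpos n x hx hxΩ1
  -- stub 2: identification of the numerator's limit
  have hcov : S' n (fun i => ι (x i)) = (∏ i, ‖x i‖ ^ (2 * Δ)) * S n x :=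
    hCov Δ hΔ Ω hΩ Ω' hΩ' hm hm' S S' hS hS' n x hx hxΩ
  -- limit of the renormalised quotient
  have hq := h2.div h1 hpos.ne'
  rw [hcov, mul_div_assoc, div_self hpos.ne', mul_one] at hq
  -- the renormalisations cancel eventually
  have hev : ∀ᶠ δ : ℝ in 𝓝[>] (0 : ℝ),
      ρ δ ^ n * G Ω δ n (fun i => latticeApprox δ (x i)) ≠ 0 := h1.eventually_ne hpos.ne'
  refine Tendsto.congr' ?_ hq
  filter_upwards [hev] with δ hδ
  rw [Pi.div_apply, mul_div_mul_left _ _ (left_ne_zero_of_mul hδ)]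

end Summit.CriticalPhenomena.Ising3DConformalLimit.Cruxes.OrbitInversionRatio.Birth
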